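import Summits.HubbardSuperconductivity.HubbardSuperconductivity.Theorems.AnisotropyChordDressHalfFilledSecondOrderLower
import HarnessLib

/-!
# Crux `DressHalfFilled` (stmt-HubbardSuperconductivity-8148, routes `AnisotropyChord` / `LevyLogBootstrap`), stub 3
# `stub_dressHalfFilled`: the SECOND-ORDER SANDWICH — first-order dressing and near-optimality of the plaquette component of
# every low-energy state (abstract, gapped unperturbed sector)

Helper file (`--supports stmt-HubbardSuperconductivity-8148`), continuing `…SecondOrderLower`. Same abstract setting: `H₀, T`
Hermitian, `P = eigenProj H₀ E₀`, `S = reducedResolvent H₀ E₀`, a sector `K` stable under `T, S, P` with `H₀ ≥ E₀` on `K`, gap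
`g` on `K ∩ ker P`, form bound `τ` for `T`, no first-order term on `PK`; `σ(p) = Re⟨Tp, S Tp⟩` the second-order gain of `p ∈ PK`.

* `kato_square_identity` — `𝒜(q + S b) = 𝒜(q) + 2Re⟨q, b⟩ + Re⟨b, S b⟩` for `q ∈ ker P` (`𝒜(v) = Re⟨v, H₀v⟩ − E₀‖v‖²`);
* `second_order_sandwich` — for every unit `ψ ∈ K` whose energy obeys a second-order UPPER bound
  `Re⟨ψ, (H₀ + tT)ψ⟩ ≤ E₀ − t²σ₀ + C t³` (e.g. a sector ground state, by `…SecondOrderUpper`), writing `p = Pψ`, `q = ψ − p`,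
  `λ = 1 − tτ/g` and `u = q + (t/λ) S T p`:
  **`λ g ‖u‖² ≤ t²(σ(p)/λ − σ₀) + C t³`**.
  Consequences (read off, not separately stated): (a) FIRST-ORDER DRESSING — since `σ(p) ≤ σ_max‖p‖² ≤ σ_max`, taking `σ₀ = σ_max`
  (the best dressed trial state) gives `‖q + (t/λ) S T p‖² = O(t³)`: the component of a ground state outside the plaquette ground
  space IS Kato's first-order correction `−t S T p` up to `O(t^{3/2})`; (b) NEAR-OPTIMALITY — `σ(p) ≥ λ(σ₀ − C t)`: the plaquette
  component `p` is an `O(t)`-approximate maximiser of the second-order gain, i.e. (dictionary clause (d)) `Φᴴp` is an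
  `O(t)`-approximate ground state of `2J·XXZ(Δ_eff) + k` — the input for the fixed-`L` concentration of ground states on the
  dressed XXZ ground state (next step; needs the XXZ sector gap, Perron).

HONEST LABEL: abstract, fixed-volume perturbation theory; nothing uniform in `L`; no statement about order yet; the content of stub 3
is untouched; no crux and no summit statement is proved. Sources: T. Kato (1966) II-§2.3 [Kato1966]; Tasaki (2020) §2.1.
No definition and no named fact is introduced; sorry-free.
-/

noncomputable section

-- `dupNamespace`: the summit and the problem are both named `HubbardSuperconductivity` (layout D-0022)
set_option linter.dupNamespace false

namespace Summit.HubbardSuperconductivity.HubbardSuperconductivity.Theorems.AnisotropyChord.DressSecond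

open Matrix Literature.MathematicalPhysics.QuantumLattice
open scoped ComplexOrder

variable {m : Type*} [Fintype m] [DecidableEq m]

/-- **Kato's square identity.** `S = reducedResolvent H₀ E₀`, `P = eigenProj H₀ E₀`, `H₀` Hermitian; for `q` with `P q = 0`
and any `b`: `𝒜(q + S b) = 𝒜(q) + 2Re⟨q, b⟩ + Re⟨b, S b⟩`, `𝒜(v) = Re⟨v, H₀ v⟩ − E₀‖v‖²`
(`(H₀ − E₀)S = 1 − P`, `P S = 0`). Kato (1966) II-§2.3. [folklore] -/
theorem kato_square_identity {H₀ : Matrix m m ℂ} (hH₀ : H₀.IsHermitian) {E₀ : ℝ} {q b : m → ℂ}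
    (hPq : eigenProj H₀ E₀ *ᵥ q = 0) :
    (star (q + reducedResolvent H₀ E₀ *ᵥ b) ⬝ᵥ (H₀ *ᵥ (q + reducedResolvent H₀ E₀ *ᵥ b))).re -
        E₀ * (star (q + reducedResolvent H₀ E₀ *ᵥ b) ⬝ᵥ (q + reducedResolvent H₀ E₀ *ᵥ b)).re =
      ((star q ⬝ᵥ (H₀ *ᵥ q)).re - E₀ * (star q ⬝ᵥ q).re) + 2 * (star q ⬝ᵥ b).re +
        (star b ⬝ᵥ (reducedResolvent H₀ E₀ *ᵥ b)).re := by
  set S := reducedResolvent H₀ E₀ with hS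
  set P := eigenProj H₀ E₀ with hP
  have hSh : S.IsHermitian := reducedResolvent_isHermitian H₀ E₀
  have hPh : P.IsHermitian := eigenProj_isHermitian H₀ E₀
  have h1 : (H₀ - algebraMap ℝ (Matrix m m ℂ) E₀) *ᵥ (S *ᵥ b) = b - P *ᵥ b := by
    rw [mulVec_mulVec, sub_mul_reducedResolvent hH₀ E₀, sub_mulVec, one_mulVec]
  have h2 : (algebraMap ℝ (Matrix m m ℂ) E₀) *ᵥ (S *ᵥ b) = (E₀ : ℂ) • (S *ᵥ b) := by
    rw [IsScalarTower.algebraMap_apply ℝ ℂ (Matrix m m ℂ), Algebra.algebraMap_eq_smul_one, smul_mulVec, one_mulVec]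
    rfl
  have hHSb : H₀ *ᵥ (S *ᵥ b) = (E₀ : ℂ) • (S *ᵥ b) + (b - P *ᵥ b) := by
    rw [← h1, sub_mulVec, h2]; abel
  have hqPb : star q ⬝ᵥ (P *ᵥ b) = 0 := by
    rw [RayleighBottom.star_dotProduct_mulVec_eq, hPh.eq, hPq, star_zero, zero_dotProduct]
  have hSbPb : star (S *ᵥ b) ⬝ᵥ (P *ᵥ b) = 0 := by
    rw [RayleighBottom.star_dotProduct_mulVec_eq, hPh.eq, mulVec_mulVec, eigenProj_mul_reducedResolvent, zero_mulVec,
      star_zero, zero_dotProduct]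
  have hSbHq : star (S *ᵥ b) ⬝ᵥ (H₀ *ᵥ q) = star ((E₀ : ℂ) • (S *ᵥ b) + (b - P *ᵥ b)) ⬝ᵥ q := by
    rw [RayleighBottom.star_dotProduct_mulVec_eq, hH₀.eq, hHSb]
  have hPbq : star (P *ᵥ b) ⬝ᵥ q = 0 := by
    rw [star_dotProduct, hqPb, star_zero]
  have e1 : star (S *ᵥ b) ⬝ᵥ q = star b ⬝ᵥ (S *ᵥ q) := by
    rw [RayleighBottom.star_dotProduct_mulVec_eq S b q, hSh.eq]
  have eH : star (q + S *ᵥ b) ⬝ᵥ (H₀ *ᵥ (q + S *ᵥ b)) =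
      star q ⬝ᵥ (H₀ *ᵥ q) + (star q ⬝ᵥ b + (E₀ : ℂ) * (star q ⬝ᵥ (S *ᵥ b))) +
        ((E₀ : ℂ) * (star b ⬝ᵥ (S *ᵥ q)) + star b ⬝ᵥ q) +
          ((E₀ : ℂ) * (star (S *ᵥ b) ⬝ᵥ (S *ᵥ b)) + star (S *ᵥ b) ⬝ᵥ b) := by
    rw [mulVec_add, star_add, add_dotProduct, dotProduct_add, dotProduct_add, hHSb, hSbHq]
    rw [dotProduct_add, dotProduct_smul, dotProduct_sub, hqPb, sub_zero, star_add, star_smul, add_dotProduct,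
      smul_dotProduct, star_sub, sub_dotProduct, hPbq, sub_zero, dotProduct_add, dotProduct_smul, dotProduct_sub,
      hSbPb, sub_zero, Complex.star_def, Complex.conj_ofReal]
    rw [e1, smul_eq_mul, smul_eq_mul, smul_eq_mul]
    ring
  have eN : star (q + S *ᵥ b) ⬝ᵥ (q + S *ᵥ b) =
      star q ⬝ᵥ q + star q ⬝ᵥ (S *ᵥ b) + (star b ⬝ᵥ (S *ᵥ q) + star (S *ᵥ b) ⬝ᵥ (S *ᵥ b)) := by
    rw [star_add, add_dotProduct, dotProduct_add, dotProduct_add, e1]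
  have r1 : (star b ⬝ᵥ q).re = (star q ⬝ᵥ b).re := by
    rw [star_dotProduct, Complex.star_def, Complex.conj_re]
  have r2 : (star (S *ᵥ b) ⬝ᵥ b).re = (star b ⬝ᵥ (S *ᵥ b)).re := by
    rw [star_dotProduct b, Complex.star_def, Complex.conj_re]
  rw [eH, eN]
  simp only [Complex.add_re, Complex.re_ofReal_mul]
  rw [r1, r2]
  ring

/-- **The second-order sandwich.** `H₀, T` Hermitian; `P = eigenProj H₀ E₀`, `S = reducedResolvent H₀ E₀`; `K` stable under `T`,
`S`, `P`; `H₀ − E₀ ≥ g > 0` on `K ∩ ker P`; `|Re⟨v, Tv⟩| ≤ τ‖v‖²` on `K`; `Re⟨Pv, T Pv⟩ = 0` on `K`. Let `ψ ∈ K` be a unit vector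
with the second-order UPPER energy bound `Re⟨ψ, (H₀ + tT)ψ⟩ ≤ E₀ − t²σ₀ + C t³`, `0 ≤ t`, `tτ < g`; put `p = Pψ`, `q = ψ − p`,
`λ = 1 − tτ/g`, `u = q + (t/λ) • S T p`. Then `λ·g·‖u‖² ≤ t²·(Re⟨Tp, S Tp⟩/λ − σ₀) + C·t³`: the off-ground-space part of `ψ` is
Kato's first-order dressing of its plaquette part up to `O(t^{3/2})`, and the plaquette part is an `O(t)`-approximate maximiser of
the second-order gain. Kato (1966) II-§2.3. [folklore] -/
theorem second_order_sandwich {H₀ T : Matrix m m ℂ} (hH₀ : H₀.IsHermitian) (hT : T.IsHermitian)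
    (K : Submodule ℂ (m → ℂ)) {E₀ g τ σ₀ C t : ℝ}
    (hKT : ∀ v ∈ K, T *ᵥ v ∈ K) (hKS : ∀ v ∈ K, reducedResolvent H₀ E₀ *ᵥ v ∈ K)
    (hKP : ∀ v ∈ K, eigenProj H₀ E₀ *ᵥ v ∈ K)
    (hg : 0 < g)
    (hgap : ∀ v ∈ K, eigenProj H₀ E₀ *ᵥ v = 0 →
      g * (star v ⬝ᵥ v).re ≤ (star v ⬝ᵥ (H₀ *ᵥ v)).re - E₀ * (star v ⬝ᵥ v).re)
    (hτ : ∀ v ∈ K, |(star v ⬝ᵥ (T *ᵥ v)).re| ≤ τ * (star v ⬝ᵥ v).re)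
    (hPTP : ∀ v ∈ K, (star (eigenProj H₀ E₀ *ᵥ v) ⬝ᵥ (T *ᵥ (eigenProj H₀ E₀ *ᵥ v))).re = 0)
    (ht0 : 0 ≤ t) (htg : t * τ < g)
    {ψ : m → ℂ} (hψ : ψ ∈ K) (hψ1 : star ψ ⬝ᵥ ψ = 1)
    (hR : (star ψ ⬝ᵥ ((H₀ + (t : ℂ) • T) *ᵥ ψ)).re ≤ E₀ - t ^ 2 * σ₀ + C * t ^ 3) :
    (1 - t * τ / g) * g *
        (star ((ψ - eigenProj H₀ E₀ *ᵥ ψ) +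
            ((t / (1 - t * τ / g) : ℝ) : ℂ) • reducedResolvent H₀ E₀ *ᵥ (T *ᵥ (eigenProj H₀ E₀ *ᵥ ψ))) ⬝ᵥ
          ((ψ - eigenProj H₀ E₀ *ᵥ ψ) +
            ((t / (1 - t * τ / g) : ℝ) : ℂ) • reducedResolvent H₀ E₀ *ᵥ (T *ᵥ (eigenProj H₀ E₀ *ᵥ ψ)))).re ≤
      t ^ 2 * ((star (T *ᵥ (eigenProj H₀ E₀ *ᵥ ψ)) ⬝ᵥ
          (reducedResolvent H₀ E₀ *ᵥ (T *ᵥ (eigenProj H₀ E₀ *ᵥ ψ)))).re / (1 - t * τ / g) - σ₀) + C * t ^ 3 := by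
  set S := reducedResolvent H₀ E₀ with hS
  set P := eigenProj H₀ E₀ with hP
  have hSh : S.IsHermitian := reducedResolvent_isHermitian H₀ E₀
  have hPh : P.IsHermitian := eigenProj_isHermitian H₀ E₀
  have hτ0 : 0 ≤ τ := by
    have h := hτ ψ hψ
    rw [hψ1, Complex.one_re, mul_one] at h
    exact (abs_nonneg _).trans h
  set lam : ℝ := 1 - t * τ / g with hlam
  have hlam0 : 0 < lam := by
    rw [hlam, sub_pos, div_lt_one hg]; exact htg
  -- decomposition `ψ = p + q`
  set p := P *ᵥ ψ with hp
  set q := ψ - p with hq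
  have hpK : p ∈ K := hKP ψ hψ
  have hqK : q ∈ K := K.sub_mem hψ hpK
  have hPq : P *ᵥ q = 0 := by
    rw [hq, mulVec_sub, hp, mulVec_mulVec, eigenProj_mul_eigenProj, sub_self]
  have hψpq : ψ = p + q := by rw [hq]; abel
  have hHp : H₀ *ᵥ p = (E₀ : ℂ) • p := mulVec_eigenProj_mulVec hH₀ E₀ ψ
  have hpq : star p ⬝ᵥ q = 0 := by
    rw [hp, star_mulVec, ← dotProduct_mulVec, hPh.eq, hPq, dotProduct_zero]
  have hqp : star q ⬝ᵥ p = 0 := by rw [star_dotProduct, hpq, star_zero]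
  have hpHq : star p ⬝ᵥ (H₀ *ᵥ q) = 0 := by
    rw [RayleighBottom.star_dotProduct_mulVec_eq, hH₀.eq, hHp, star_smul, smul_dotProduct, hpq, smul_zero]
  have hqHp : star q ⬝ᵥ (H₀ *ᵥ p) = 0 := by
    rw [hHp, dotProduct_smul, hqp, smul_zero]
  have hqTp : (star q ⬝ᵥ (T *ᵥ p)).re = (star p ⬝ᵥ (T *ᵥ q)).re := by
    rw [RayleighBottom.star_dotProduct_mulVec_eq, hT.eq, star_dotProduct, Complex.star_def, Complex.conj_re]
  set np : ℝ := (star p ⬝ᵥ p).re with hnp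
  set nq : ℝ := (star q ⬝ᵥ q).re with hnq
  have hnq0 : 0 ≤ nq := (Complex.nonneg_iff.mp (dotProduct_star_self_nonneg q)).1
  have hnorm : np + nq = 1 := by
    have h := congrArg Complex.re hψ1
    rw [hψpq, star_add, add_dotProduct, dotProduct_add, dotProduct_add, hpq, hqp, add_zero, zero_add,
      Complex.add_re, Complex.one_re] at h
    rw [hnp, hnq]; exact h
  set A : ℝ := (star q ⬝ᵥ (H₀ *ᵥ q)).re - E₀ * nq with hA
  set η : ℝ := (star q ⬝ᵥ (T *ᵥ p)).re with hη
  set θ : ℝ := (star q ⬝ᵥ (T *ᵥ q)).re with hθ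
  have hRe : (star ψ ⬝ᵥ ((H₀ + (t : ℂ) • T) *ᵥ ψ)).re = E₀ + A + 2 * t * η + t * θ := by
    have e : star ψ ⬝ᵥ ((H₀ + (t : ℂ) • T) *ᵥ ψ) =
        (E₀ : ℂ) * (star p ⬝ᵥ p) + star q ⬝ᵥ (H₀ *ᵥ q) +
          (t : ℂ) * (star p ⬝ᵥ (T *ᵥ p) + star p ⬝ᵥ (T *ᵥ q) + star q ⬝ᵥ (T *ᵥ p) + star q ⬝ᵥ (T *ᵥ q)) := by
      rw [add_mulVec, smul_mulVec, dotProduct_add, dotProduct_smul, smul_eq_mul]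
      conv_lhs => rw [hψpq]
      rw [star_add, mulVec_add, mulVec_add, add_dotProduct, dotProduct_add, dotProduct_add, add_dotProduct,
        dotProduct_add, dotProduct_add, hpHq, hqHp, hHp, dotProduct_smul, smul_eq_mul]
      ring
    rw [e]
    simp only [Complex.add_re, Complex.re_ofReal_mul]
    rw [hPTP ψ hψ, ← hqTp, ← hnp, ← hη, ← hθ, hA]
    have : np = 1 - nq := by linarith
    rw [this]; ring
  have hAq : g * nq ≤ A := by
    have h := hgap q hqK hPq
    rw [← hnq] at h; rw [hA]; linarith
  have hθq : -(τ * nq) ≤ θ := by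
    have h := hτ q hqK
    rw [← hnq, ← hθ] at h
    exact neg_le_of_abs_le h
  -- the dressing vector `b = (t/λ) T p` and `u = q + S b`
  set b : m → ℂ := ((t / lam : ℝ) : ℂ) • (T *ᵥ p) with hb
  have hSb : S *ᵥ b = ((t / lam : ℝ) : ℂ) • (S *ᵥ (T *ᵥ p)) := by rw [hb, mulVec_smul]
  have huK : q + S *ᵥ b ∈ K := K.add_mem hqK (hKS _ (K.smul_mem _ (hKT p hpK)))
  have hPu : P *ᵥ (q + S *ᵥ b) = 0 := by
    rw [mulVec_add, hPq, zero_add, mulVec_mulVec, eigenProj_mul_reducedResolvent, zero_mulVec]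
  -- Kato's identity and the gap on `u`
  have hsq := kato_square_identity hH₀ (E₀ := E₀) (b := b) hPq
  have hgu := hgap _ huK hPu
  -- the coefficients
  have e1 : (star q ⬝ᵥ b).re = t / lam * η := by
    rw [hb, dotProduct_smul, smul_eq_mul, Complex.re_ofReal_mul, hη]
  have e2 : (star b ⬝ᵥ (S *ᵥ b)).re = (t / lam) ^ 2 * (star (T *ᵥ p) ⬝ᵥ (S *ᵥ (T *ᵥ p))).re := by
    rw [hb, mulVec_smul, star_smul, smul_dotProduct, dotProduct_smul, Complex.star_def, Complex.conj_ofReal, smul_eq_mul,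
      smul_eq_mul, ← mul_assoc, ← Complex.ofReal_mul, Complex.re_ofReal_mul]
    ring
  rw [← hnq, ← hA, e1, e2] at hsq
  -- `R − E₀ = A + 2tη + tθ ≥ λ A + 2 t η = λ(𝒜(u) − Re⟨b,Sb⟩) ≥ λ g ‖u‖² − (t²/λ) σ(p)`
  rw [hRe] at hR
  have h1 : t * τ * nq ≤ t * τ / g * A := by
    rw [div_mul_eq_mul_div, le_div_iff₀ hg]
    calc t * τ * nq * g = t * τ * (g * nq) := by ring
      _ ≤ t * τ * A := mul_le_mul_of_nonneg_left hAq (by positivity)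
  have h2 : -(t * τ * nq) ≤ t * θ := by
    have := mul_le_mul_of_nonneg_left hθq ht0
    linarith
  -- `𝒜(u)` in terms of `A, η, σ(p)`: `𝒜(u) = A + 2 (t/λ) η + (t/λ)² σ(p)` (this is `hsq`)
  set Au : ℝ := (star (q + S *ᵥ b) ⬝ᵥ (H₀ *ᵥ (q + S *ᵥ b))).re -
      E₀ * (star (q + S *ᵥ b) ⬝ᵥ (q + S *ᵥ b)).re with hAu
  set nu : ℝ := (star (q + S *ᵥ b) ⬝ᵥ (q + S *ᵥ b)).re with hnu
  have hgu' : g * nu ≤ Au := by rw [hAu, hnu]; linarith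
  -- target rewritten with `u = q + S b`
  have hu_eq : (ψ - P *ᵥ ψ) + ((t / (1 - t * τ / g) : ℝ) : ℂ) • S *ᵥ (T *ᵥ (P *ᵥ ψ)) = q + S *ᵥ b := by
    rw [hSb, ← hlam, ← hp, ← hq]
  rw [hu_eq, ← hnu]
  -- the algebra: λ·Au = λA + 2tη + (t²/λ)σ(p) ≤ (R − E₀ − tθ + ...)...
  have key : lam * Au = lam * A + 2 * t * η + t ^ 2 / lam * (star (T *ᵥ p) ⬝ᵥ (S *ᵥ (T *ᵥ p))).re := by
    rw [hsq]
    field_simp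
  -- from `hR`: `A + 2tη + tθ ≤ −t²σ₀ + C t³`, and `tθ ≥ −(tτ/g) A` so `λ A + 2 t η ≤ −t²σ₀ + C t³`
  have hup : lam * A + 2 * t * η ≤ -(t ^ 2 * σ₀) + C * t ^ 3 := by
    rw [hlam]
    nlinarith
  have hfinal : lam * g * nu ≤ lam * Au := by
    have := mul_le_mul_of_nonneg_left hgu' hlam0.le
    linarith
  have hdiv : t ^ 2 / lam * (star (T *ᵥ p) ⬝ᵥ (S *ᵥ (T *ᵥ p))).re =
      t ^ 2 * ((star (T *ᵥ p) ⬝ᵥ (S *ᵥ (T *ᵥ p))).re / lam) := by ring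
  linarith

end Summit.HubbardSuperconductivity.HubbardSuperconductivity.Theorems.AnisotropyChord.DressSecond

end
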